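import Literature.NumberTheory.Automorphic.GaloisActionPlaces                        -- ★ `g • w` on `HeightOneSpectrum`, `HeightOneSpectrum.smul_asIdeal`
import Literature.NumberTheory.DiophantineGeometry.AbelianVarietyOrdinaryReduction     -- ★ `geomResidueField`
import Mathlib.NumberTheory.NumberField.CMField
import Mathlib.FieldTheory.Finite.Basic
import HarnessLib

/-!
# The numerology rows `pChar hpChar fDeg hpCharConj hfDeg charP₀` of a finite place of a CM field (helper for `stub_GSPREAD`, crux hLiu418)

Cell `hodgecm-mathlib` (D-0151), P6 «MOD programme» (crux hLiu418 = stmt-HodgeConjecture-24832, `--supports … --as helper`, count-neutral); P-LINE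
closer leaf `Cruxes/HLiu418/Lines/F0_P6a_PELSpread.lean`, socket `stub_GSPREAD` («L4» LA4-plan DEAL #10, LA4-p03 assembly pen; census
`CENSUS-stubGSPREAD-assembly.v1` hole (N)).  HC_CM is proved only modulo the printed citations until rung 0 closes; nothing here is about HC.

The six arithmetic rows of `PELSpreadAt` (`pChar`, `hpChar : p.Prime ∧ (p : 𝓞 F) ∈ 𝔭_w`, `fDeg`, `hpCharConj : (p : 𝓞 F) ∈ 𝔭_{c•w}`,
`hfDeg : #(𝓞 F ⧸ 𝔭_{c•w}) = p ^ f`, `charP₀ : CharP κ̄(w) p`) are consumed as hypotheses everywhere in the P6a tree and produced nowhere; this file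
produces them for EVERY finite place `w` of a CM field `F` (no splitting hypothesis needed): `p := char κ(w)` is a prime lying in `𝔭_w` (the norm
`N(𝔭_w) ≠ 0` dies in `κ(w)`), complex conjugation fixes `p` so `p ∈ c • 𝔭_w = 𝔭_{c•w}`, the residue ring `𝓞 F ⧸ 𝔭_{c•w}` is a finite field of
characteristic `p` hence of cardinality `p ^ f`, and `κ̄(w) ⊇ κ(w)` has characteristic `p`.

* `exists_splitPrime_numerology` — THE HEAD.

## References
* [NeukirchANT1999] J. Neukirch, *Algebraic Number Theory* (1999), Ch. I §8 (residue degrees), Ch. II (8.1).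
* [SerreTate1968] J.-P. Serre, J. Tate, *Good reduction of abelian varieties*, Ann. of Math. 88 (1968), §1 (the residue fields `κ(v) ⊆ κ̄(v)`).
-/

set_option autoImplicit false

-- `Summit.HodgeConjecture.HodgeConjecture.…` repeats `HodgeConjecture` by design (D-0017).
set_option linter.dupNamespace false

noncomputable section

open NumberField IsDedekindDomain
open scoped Pointwise
open Literature.NumberTheory.DiophantineGeometry (geomResidueField)

namespace Summit.HodgeConjecture.HodgeConjecture.Theorems.F0P6aSplitPrimeNumerology

variable {F : Type} [Field F] [NumberField F] [IsCMField F] (w : HeightOneSpectrum (𝓞 F))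

/-- **THE NUMEROLOGY ROWS OF A FINITE PLACE `w` OF A CM FIELD**: there are a prime `p` and an exponent `f` with `p ∈ 𝔭_w`, `p ∈ 𝔭_{c•w}`,
`#(𝓞 F ⧸ 𝔭_{c•w}) = p ^ f` and `char κ̄(w) = p` — the rows `pChar hpChar fDeg hpCharConj hfDeg charP₀` of the P-line's `PELSpreadAt`.
[cite: NeukirchANT1999, Ch. I §8 and Ch. II (8.1)] [cite: SerreTate1968, §1] -/
theorem exists_splitPrime_numerology :
    ∃ p f : ℕ, p.Prime ∧ (p : 𝓞 F) ∈ w.asIdeal ∧ (p : 𝓞 F) ∈ ((IsCMField.complexConj F) • w).asIdeal ∧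
      Nat.card (𝓞 F ⧸ ((IsCMField.complexConj F) • w).asIdeal) = p ^ f ∧ CharP (geomResidueField w) p := by
  classical
  obtain ⟨p, hchar⟩ := CharP.exists w.asIdeal.ResidueField
  -- `p ∈ 𝔭_w`
  have hpw : (p : 𝓞 F) ∈ w.asIdeal := by
    rw [← Ideal.ker_algebraMap_residueField w.asIdeal, RingHom.mem_ker, map_natCast]
    exact CharP.cast_eq_zero _ p
  -- `p` is prime: the norm of `𝔭_w` is a nonzero natural number dying in `κ(w)`
  have hp0 : p ≠ 0 := by
    intro h0
    have hN : ((Ideal.absNorm w.asIdeal : ℕ) : w.asIdeal.ResidueField) = 0 := by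
      rw [← map_natCast (algebraMap (𝓞 F) w.asIdeal.ResidueField), ← RingHom.mem_ker, Ideal.ker_algebraMap_residueField]
      exact Ideal.absNorm_mem _
    rw [CharP.cast_eq_zero_iff w.asIdeal.ResidueField p, h0, zero_dvd_iff, Ideal.absNorm_eq_zero_iff] at hN
    exact w.ne_bot hN
  have hp : p.Prime := (CharP.char_is_prime_or_zero w.asIdeal.ResidueField p).resolve_right hp0
  -- `p ∈ 𝔭_{c • w} = c • 𝔭_w` (complex conjugation fixes the natural number `p`)
  have hfix : (IsCMField.complexConj F) • ((p : ℕ) : 𝓞 F) = (p : 𝓞 F) := by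
    rw [← MulSemiringAction.toRingHom_apply, map_natCast]
  have hpcw : (p : 𝓞 F) ∈ ((IsCMField.complexConj F) • w).asIdeal := by
    rw [Literature.NumberTheory.Automorphic.HeightOneSpectrum.smul_asIdeal, ← hfix]
    exact Ideal.smul_mem_pointwise_smul_iff.mpr hpw
  -- the residue ring at `c • w` is a finite field of characteristic `p`
  haveI : ((IsCMField.complexConj F) • w).asIdeal.IsMaximal :=
    Ring.DimensionLEOne.maximalOfPrime ((IsCMField.complexConj F) • w).ne_bot ((IsCMField.complexConj F) • w).isPrime
  letI : Field (𝓞 F ⧸ ((IsCMField.complexConj F) • w).asIdeal) := Ideal.Quotient.field _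
  haveI : Finite (𝓞 F ⧸ ((IsCMField.complexConj F) • w).asIdeal) :=
    Ideal.finiteQuotientOfFreeOfNeBot _ ((IsCMField.complexConj F) • w).ne_bot
  letI : Fintype (𝓞 F ⧸ ((IsCMField.complexConj F) • w).asIdeal) := Fintype.ofFinite _
  obtain ⟨q, hq⟩ := CharP.exists (𝓞 F ⧸ ((IsCMField.complexConj F) • w).asIdeal)
  have hq0 : ((p : ℕ) : 𝓞 F ⧸ ((IsCMField.complexConj F) • w).asIdeal) = 0 := by
    rw [← map_natCast (Ideal.Quotient.mk ((IsCMField.complexConj F) • w).asIdeal), Ideal.Quotient.eq_zero_iff_mem]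
    exact hpcw
  have hqp : q = p := by
    have hdvd : q ∣ p := (CharP.cast_eq_zero_iff _ q p).mp hq0
    rcases CharP.char_is_prime_or_zero (𝓞 F ⧸ ((IsCMField.complexConj F) • w).asIdeal) q with hqprime | hq0'
    · exact (Nat.prime_dvd_prime_iff_eq hqprime hp).mp hdvd
    · exfalso
      rw [hq0', zero_dvd_iff] at hdvd
      exact hp0 hdvd
  subst hqp
  obtain ⟨n, -, hn⟩ := FiniteField.card (𝓞 F ⧸ ((IsCMField.complexConj F) • w).asIdeal) q
  refine ⟨q, n, hp, hpw, hpcw, ?_, ?_⟩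
  · rw [Nat.card_eq_fintype_card, hn]
  · exact charP_of_injective_algebraMap (algebraMap w.asIdeal.ResidueField (geomResidueField w)).injective q

end Summit.HodgeConjecture.HodgeConjecture.Theorems.F0P6aSplitPrimeNumerology

end
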